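/-
Copyright (c) 2026. All rights reserved.
Released under Apache 2.0 license as described in the file LICENSE.
-/
import Summits.HodgeConjecture.HodgeConjecture.Theorems.K2LiuArchLadderRungTransfer   -- ★ G6-arch asm FILE 2 p861662 (`anchor`, bookkeeping; brings ★ (H2-alg), ★ (H2-an) FILES 1–3, ★ asm FILE 1)
import HarnessLib

/-!
# Crux `HLiu418`, G6-arch ASSEMBLY FILE 4: THE PAIR TRANSPORT `(cp F, cp M_w F)` UNDER `𝔤_ℂ` — sections for EVERY word, sums of words, and the scalar extraction
# (handles the «polluted» arrows `+e₂`, `−e₁` of ★ S2-T, whose images straddle two `K_w`-types, via `𝔨`-words and sums)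

Cell `hodgecm-mathlib`, crux item hLiu418 = `stmt-HodgeConjecture-24832` (helper lane `--supports`, count-neutral).

★ asm FILE 2 `rung_transfer`∕`ladder` assume at each rung an EXACT eigen-arrow `Op^{(s)} P = a • P₁`, `Op^{(−s)} P = b • P₁` — true for `+e₁ = M₀₀` and `−e₂ = P₁₁`
on highest-weight vectors (★ S2-T `mOp_zero_zero_fkl`, `pOp_one_one_fkl`), false for `+e₂`, `−e₁` (★ `succ_smul_mOp_one_one_fkl`, `succ_smul_pOp_zero_zero_fkl`
carry a second component `H_k D^l` in the neighbouring type).  The invariant that survives is the PAIR `(Q, Q′) := (cp F, cp M_w F)`: it is transported by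
`(Op^{(k,s)}_X, Op^{(k,−s)}_X)` for every `X ∈ 𝔤_ℂ` (no proportionality needed), is additive and homogeneous in `F`, starts at `(D^{−k}, c_k(s)·D^{−k})`, and the
scalar is read off at the end whenever `Q = A • P`, `Q′ = B • P`, `A ≠ 0`.  So every element `Φ·f⁰` (`Φ ∈ U(𝔤_ℂ)`, in particular `𝔨`-projectors composed with
`𝔭^±`) is covered by finitely many applications, BY VALUE.
* §1 `integrable_bigCell` — every section with a compact picture has an integrable big-cell integrand at `g ∈ U(J)` (★ (H2-an) FILES 1–2), `re s > ½`.
* §2 `pair_add`, `pair_const_mul` — the pair is additive ∕ homogeneous (rung 0 as a pair = ★ asm FILE 2 `anchor`).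
* §3 **`rung_pair`** — `F ∈ I_w(s,χ_k)`, `cp F = Q`, `cp M_w F = Q′`, any blocks `(αβγδ)`: the rung section `F₁ := D_{X₁}F + i·D_{X₂}F` has
  `F₁ ∈ I_w(s,χ_k)`, `cp F₁ = Op^{(k,s)}_{(αβγδ)} Q`, `cp M_w F₁ = Op^{(k,−s)}_{(αβγδ)} Q′`.
* §4 **`ladder_pair`** — along any word: `∃ F ∈ I_w(s,χ_k)`, `cp F = Q_n`, `cp M_w F = c_k(s) • Q′_n` for consumer-supplied sequences `Q_{i+1} = Op^{(s)}_i Q_i`,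
  `Q′_{i+1} = Op^{(−s)}_i Q′_i`, `Q_0 = Q′_0 = D^{−k}` (★ `op_smul` pulls `c_k(s)` through).
* §5 **`scalar_of_pair`** — `Q = A • P`, `Q′ = B • P`, `A ≠ 0` ⇒ the section `A⁻¹·F` has `cp = P`, `cp M_w = (B∕A) • P`.
References: [LeeZhu1998, §5 p. 5032, Prop. 5.4]; [Knapp1986, Ch. VIII §3]; [KashiwaraVergne1978, §II.5]; [Shimura1982, (1.31)].
HONEST LABEL: HC_CM is proved only modulo the 7 printed citations (2 remaining named inputs: hLiu418 = stmt-HodgeConjecture-24832,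
h413 = stmt-HodgeConjecture-24833) until rung 0 closes; count-neutral helper, closes no socket.
-/

set_option autoImplicit false
set_option linter.dupNamespace false

noncomputable section

open Complex Matrix MeasureTheory NormedSpace
open scoped ComplexConjugate ComplexOrder

namespace Summit.HodgeConjecture.HodgeConjecture.Cruxes.HLiu418.K2LiuArchLadderPairTransport

open Literature.NumberTheory.ModularForms.SiegelUpperHalfSpace (denom)
open Summit.HodgeConjecture.HodgeConjecture.Cruxes.HLiu418.K2LiuArchInducedTubeDefs
open Summit.HodgeConjecture.HodgeConjecture.Cruxes.HLiu418.K2LiuU22ShilovCoordinate (kU_mem_UJ)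
open Summit.HodgeConjecture.HodgeConjecture.Cruxes.HLiu418.K2LiuU22CompactPictureDefs
open Summit.HodgeConjecture.HodgeConjecture.Cruxes.HLiu418.K2LiuU22CompactPictureOperatorDictionary
open Summit.HodgeConjecture.HodgeConjecture.Cruxes.HLiu418.K2LiuArchSWOnePlaceRegion (op_re_add_I_smul_im cayley_re_mem_lie cayley_im_mem_lie isArchSiegelSection_add)
open Summit.HodgeConjecture.HodgeConjecture.Cruxes.HLiu418.K2LiuArchIntertwiningKTypeLadder (op_smul apply_kU_eq_evalAt_op_of_hasDerivAt)
open Summit.HodgeConjecture.HodgeConjecture.Cruxes.HLiu418.K2LiuArchIntertwiningDominatedSwap (integrable_of_dominated)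
open Summit.HodgeConjecture.HodgeConjecture.Cruxes.HLiu418.K2LiuArchKFiniteSectionMajorised (exists_norm_apply_le continuousOn_UJ)
open Summit.HodgeConjecture.HodgeConjecture.Cruxes.HLiu418.K2LiuArchIntertwiningKFiniteSwap (isArchSiegelSection_rayDeriv rayDeriv_kU_eq_evalAt_op integrable_and_hasDerivAt_archIntertwining_rayDeriv)
open Summit.HodgeConjecture.HodgeConjecture.Cruxes.HLiu418.K2LiuArchIntertwiningSiegelLaw (isArchSiegelSection_archIntertwining)
open Summit.HodgeConjecture.HodgeConjecture.Cruxes.HLiu418.K2LiuArchNormalisingScalar (archScalarCoeff)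
open Summit.HodgeConjecture.HodgeConjecture.Cruxes.HLiu418.K2LiuArchIntertwiningRightEquivariance (archIntertwining_add archIntertwining_const_mul)
open Summit.HodgeConjecture.HodgeConjecture.Cruxes.HLiu418.K2LiuArchLadderRungTransfer (isArchSiegelSection_const_mul evalAt_add_I_mul anchor)

/-! ## §1  Integrability of the big-cell integrand of a section with a compact picture -/

/-- every `F ∈ I_w(s,χ_k)` with a compact picture has an integrable big-cell integrand `r ↦ F(J·n(r)·g)` at every `g ∈ U(J)` (`re s > ½`):
★ (H2-an) FILE 2 (`continuousOn_UJ`, `exists_norm_apply_le`) + FILE 1 `integrable_of_dominated`. [Knapp1986, Ch. VII §§3–4] [Shimura1997, §16.4] -/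
theorem integrable_bigCell (k : ℤ) {s : ℂ} (hs : 1 / 2 < s.re) {F : Matrix (Fin 2 ⊕ Fin 2) (Fin 2 ⊕ Fin 2) ℂ → ℂ}
    (hF : IsArchSiegelSection (fun z : ℂ => (conj z / ((‖z‖ : ℝ) : ℂ)) ^ k) s F) (Q : Carrier)
    (hFQ : ∀ (v : Matrix (Fin 2) (Fin 2) ℂ), vᴴ * v = 1 → ∀ hv : v.det ≠ 0, F ((2 : ℂ)⁻¹ • fromBlocks (1 + v) (-(I • (1 - v))) (I • (1 - v)) (1 + v) : Matrix (Fin 2 ⊕ Fin 2) (Fin 2 ⊕ Fin 2) ℂ) = evalAt v hv Q)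
    {g : Matrix (Fin 2 ⊕ Fin 2) (Fin 2 ⊕ Fin 2) ℂ} (hg : gᴴ * Matrix.J (Fin 2) ℂ * g = Matrix.J (Fin 2) ℂ) :
    Integrable (fun r : Fin 2 → Fin 2 → ℝ => F (Matrix.J (Fin 2) ℂ * fromBlocks 1 (hermOfReal r) 0 1 * g)) := by
  obtain ⟨C, -, hC⟩ := exists_norm_apply_le k s hF Q hFQ
  exact integrable_of_dominated hs hg F (continuousOn_UJ k s hF Q hFQ) hC

/-! ## §2  The pair `(cp F, cp M_w F)` is additive and homogeneous -/

/-- **ADDITIVITY OF THE PAIR**: `(cp, cp M_w)(F + G) = (Q₁ + Q₂, Q′₁ + Q′₂)` (`re s > ½`; linearity of `M_w` under §1's integrability). [folklore] -/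
theorem pair_add (k : ℤ) {s : ℂ} (hs : 1 / 2 < s.re) {F G : Matrix (Fin 2 ⊕ Fin 2) (Fin 2 ⊕ Fin 2) ℂ → ℂ}
    (hF : IsArchSiegelSection (fun z : ℂ => (conj z / ((‖z‖ : ℝ) : ℂ)) ^ k) s F) (hG : IsArchSiegelSection (fun z : ℂ => (conj z / ((‖z‖ : ℝ) : ℂ)) ^ k) s G) (Q₁ Q₂ Q₁' Q₂' : Carrier)
    (hFQ : ∀ (v : Matrix (Fin 2) (Fin 2) ℂ), vᴴ * v = 1 → ∀ hv : v.det ≠ 0, F ((2 : ℂ)⁻¹ • fromBlocks (1 + v) (-(I • (1 - v))) (I • (1 - v)) (1 + v) : Matrix (Fin 2 ⊕ Fin 2) (Fin 2 ⊕ Fin 2) ℂ) = evalAt v hv Q₁)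
    (hGQ : ∀ (v : Matrix (Fin 2) (Fin 2) ℂ), vᴴ * v = 1 → ∀ hv : v.det ≠ 0, G ((2 : ℂ)⁻¹ • fromBlocks (1 + v) (-(I • (1 - v))) (I • (1 - v)) (1 + v) : Matrix (Fin 2 ⊕ Fin 2) (Fin 2 ⊕ Fin 2) ℂ) = evalAt v hv Q₂)
    (hFM : ∀ (u : Matrix (Fin 2) (Fin 2) ℂ), uᴴ * u = 1 → ∀ hu' : u.det ≠ 0,
        archIntertwining F ((2 : ℂ)⁻¹ • fromBlocks (1 + u) (-(I • (1 - u))) (I • (1 - u)) (1 + u) : Matrix (Fin 2 ⊕ Fin 2) (Fin 2 ⊕ Fin 2) ℂ) = evalAt u hu' Q₁')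
    (hGM : ∀ (u : Matrix (Fin 2) (Fin 2) ℂ), uᴴ * u = 1 → ∀ hu' : u.det ≠ 0,
        archIntertwining G ((2 : ℂ)⁻¹ • fromBlocks (1 + u) (-(I • (1 - u))) (I • (1 - u)) (1 + u) : Matrix (Fin 2 ⊕ Fin 2) (Fin 2 ⊕ Fin 2) ℂ) = evalAt u hu' Q₂') :
    IsArchSiegelSection (fun z : ℂ => (conj z / ((‖z‖ : ℝ) : ℂ)) ^ k) s (fun y => F y + G y) ∧
      (∀ (v : Matrix (Fin 2) (Fin 2) ℂ), vᴴ * v = 1 → ∀ hv : v.det ≠ 0, (fun y => F y + G y) ((2 : ℂ)⁻¹ • fromBlocks (1 + v) (-(I • (1 - v))) (I • (1 - v)) (1 + v) : Matrix (Fin 2 ⊕ Fin 2) (Fin 2 ⊕ Fin 2) ℂ) = evalAt v hv (Q₁ + Q₂)) ∧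
      (∀ (u : Matrix (Fin 2) (Fin 2) ℂ), uᴴ * u = 1 → ∀ hu' : u.det ≠ 0,
        archIntertwining (fun y => F y + G y) ((2 : ℂ)⁻¹ • fromBlocks (1 + u) (-(I • (1 - u))) (I • (1 - u)) (1 + u) : Matrix (Fin 2 ⊕ Fin 2) (Fin 2 ⊕ Fin 2) ℂ) = evalAt u hu' (Q₁' + Q₂')) := by
  refine ⟨isArchSiegelSection_add hF hG, fun v hv hv' => ?_, fun u hu hu' => ?_⟩
  · beta_reduce
    rw [hFQ v hv hv', hGQ v hv hv', map_add]
  · rw [archIntertwining_add (integrable_bigCell k hs hF Q₁ hFQ (kU_mem_UJ hu)) (integrable_bigCell k hs hG Q₂ hGQ (kU_mem_UJ hu)),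
      hFM u hu hu', hGM u hu hu', map_add]

/-- **HOMOGENEITY OF THE PAIR**: `(cp, cp M_w)(c·F) = (c • Q, c • Q′)`. [folklore] -/
theorem pair_const_mul (k : ℤ) (s : ℂ) {F : Matrix (Fin 2 ⊕ Fin 2) (Fin 2 ⊕ Fin 2) ℂ → ℂ}
    (hF : IsArchSiegelSection (fun z : ℂ => (conj z / ((‖z‖ : ℝ) : ℂ)) ^ k) s F) (Q Q' : Carrier) (c : ℂ)
    (hFQ : ∀ (v : Matrix (Fin 2) (Fin 2) ℂ), vᴴ * v = 1 → ∀ hv : v.det ≠ 0, F ((2 : ℂ)⁻¹ • fromBlocks (1 + v) (-(I • (1 - v))) (I • (1 - v)) (1 + v) : Matrix (Fin 2 ⊕ Fin 2) (Fin 2 ⊕ Fin 2) ℂ) = evalAt v hv Q)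
    (hFM : ∀ (u : Matrix (Fin 2) (Fin 2) ℂ), uᴴ * u = 1 → ∀ hu' : u.det ≠ 0,
        archIntertwining F ((2 : ℂ)⁻¹ • fromBlocks (1 + u) (-(I • (1 - u))) (I • (1 - u)) (1 + u) : Matrix (Fin 2 ⊕ Fin 2) (Fin 2 ⊕ Fin 2) ℂ) = evalAt u hu' Q') :
    IsArchSiegelSection (fun z : ℂ => (conj z / ((‖z‖ : ℝ) : ℂ)) ^ k) s (fun y => c * F y) ∧
      (∀ (v : Matrix (Fin 2) (Fin 2) ℂ), vᴴ * v = 1 → ∀ hv : v.det ≠ 0, (fun y => c * F y) ((2 : ℂ)⁻¹ • fromBlocks (1 + v) (-(I • (1 - v))) (I • (1 - v)) (1 + v) : Matrix (Fin 2 ⊕ Fin 2) (Fin 2 ⊕ Fin 2) ℂ) = evalAt v hv (c • Q)) ∧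
      (∀ (u : Matrix (Fin 2) (Fin 2) ℂ), uᴴ * u = 1 → ∀ hu' : u.det ≠ 0,
        archIntertwining (fun y => c * F y) ((2 : ℂ)⁻¹ • fromBlocks (1 + u) (-(I • (1 - u))) (I • (1 - u)) (1 + u) : Matrix (Fin 2 ⊕ Fin 2) (Fin 2 ⊕ Fin 2) ℂ) = evalAt u hu' (c • Q')) := by
  refine ⟨isArchSiegelSection_const_mul c hF, fun v hv hv' => ?_, fun u hu hu' => ?_⟩
  · beta_reduce
    rw [hFQ v hv hv', map_smul, smul_eq_mul]
  · rw [archIntertwining_const_mul, hFM u hu hu', map_smul, smul_eq_mul]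

/-! ## §3  One rung, pair form -/

/-- **THE RUNG IN PAIR FORM** (`re s > ½`, ANY blocks `(α,β,γ,δ)`, no eigen-arrow needed).  `F ∈ I_w(s,χ_k)` with `cp F = Q` and `cp M_w F = Q′`; the rung section
`F₁ := y ↦ D_{X₁}F (y) + i·D_{X₂}F (y)` (`X₁ = C·re(αβγδ)·C′`, `X₂ = C·im(αβγδ)·C′ ∈ 𝔲(J)`, ★ `cayley_re∕im_mem_lie`) satisfies (i) `F₁ ∈ I_w(s,χ_k)`,
(ii) `cp F₁ = Op^{(k,s)}_{(αβγδ)} Q`, (iii) `cp M_w F₁ = Op^{(k,−s)}_{(αβγδ)} Q′`.  (ii): ★ `rayDeriv_kU_eq_evalAt_op` ×2 + ★ `op_re_add_I_smul_im`; (iii): linearity (§1) +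
★ `apply_kU_eq_evalAt_op_of_hasDerivAt` at `s′ = −s` for `G := M_w F ∈ I_w(−s,χ_k)` (★ asm FILE 1) with the swap binders ★ (H2-an) FILE 3, + ★ `op_re_add_I_smul_im` at `−s`.
[LeeZhu1998, §5 p. 5032] [Knapp1986, Ch. VIII §3] -/
theorem rung_pair (k : ℤ) {s : ℂ} (hs : 1 / 2 < s.re) {F : Matrix (Fin 2 ⊕ Fin 2) (Fin 2 ⊕ Fin 2) ℂ → ℂ}
    (hF : IsArchSiegelSection (fun z : ℂ => (conj z / ((‖z‖ : ℝ) : ℂ)) ^ k) s F) (Q Q' : Carrier)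
    (hFQ : ∀ (v : Matrix (Fin 2) (Fin 2) ℂ), vᴴ * v = 1 → ∀ hv : v.det ≠ 0, F ((2 : ℂ)⁻¹ • fromBlocks (1 + v) (-(I • (1 - v))) (I • (1 - v)) (1 + v) : Matrix (Fin 2 ⊕ Fin 2) (Fin 2 ⊕ Fin 2) ℂ) = evalAt v hv Q)
    (hFM : ∀ (u : Matrix (Fin 2) (Fin 2) ℂ), uᴴ * u = 1 → ∀ hu' : u.det ≠ 0,
        archIntertwining F ((2 : ℂ)⁻¹ • fromBlocks (1 + u) (-(I • (1 - u))) (I • (1 - u)) (1 + u) : Matrix (Fin 2 ⊕ Fin 2) (Fin 2 ⊕ Fin 2) ℂ) = evalAt u hu' Q')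
    (α β γ δ : Matrix (Fin 2) (Fin 2) ℂ) :
    IsArchSiegelSection (fun z : ℂ => (conj z / ((‖z‖ : ℝ) : ℂ)) ^ k) s
        (fun y : Matrix (Fin 2 ⊕ Fin 2) (Fin 2 ⊕ Fin 2) ℂ => deriv (fun t : ℝ => F (y * exp (t • (fromBlocks 1 1 (I • 1) (-(I • 1)) * fromBlocks ((2 : ℂ)⁻¹ • (α - (α)ᴴ)) ((2 : ℂ)⁻¹ • (β + (γ)ᴴ)) ((2 : ℂ)⁻¹ • (γ + (β)ᴴ)) ((2 : ℂ)⁻¹ • (δ - (δ)ᴴ)) * ((2 : ℂ)⁻¹ • fromBlocks 1 (-(I • 1)) 1 (I • 1)) : Matrix (Fin 2 ⊕ Fin 2) (Fin 2 ⊕ Fin 2) ℂ)))) 0 + I * deriv (fun t : ℝ => F (y * exp (t • (fromBlocks 1 1 (I • 1) (-(I • 1)) * fromBlocks ((2 * I : ℂ)⁻¹ • (α + (α)ᴴ)) ((2 * I : ℂ)⁻¹ • (β - (γ)ᴴ)) ((2 * I : ℂ)⁻¹ • (γ - (β)ᴴ)) ((2 * I : ℂ)⁻¹ • (δ + (δ)ᴴ))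 * ((2 : ℂ)⁻¹ • fromBlocks 1 (-(I • 1)) 1 (I • 1)) : Matrix (Fin 2 ⊕ Fin 2) (Fin 2 ⊕ Fin 2) ℂ)))) 0) ∧
      (∀ (v : Matrix (Fin 2) (Fin 2) ℂ), vᴴ * v = 1 → ∀ hv : v.det ≠ 0,
        (fun y : Matrix (Fin 2 ⊕ Fin 2) (Fin 2 ⊕ Fin 2) ℂ => deriv (fun t : ℝ => F (y * exp (t • (fromBlocks 1 1 (I • 1) (-(I • 1)) * fromBlocks ((2 : ℂ)⁻¹ • (α - (α)ᴴ)) ((2 : ℂ)⁻¹ • (β + (γ)ᴴ)) ((2 : ℂ)⁻¹ • (γ + (β)ᴴ)) ((2 : ℂ)⁻¹ • (δ - (δ)ᴴ)) * ((2 : ℂ)⁻¹ • fromBlocks 1 (-(I • 1)) 1 (I • 1)) : Matrix (Fin 2 ⊕ Fin 2) (Fin 2 ⊕ Fin 2) ℂ)))) 0 + I * deriv (fun t : ℝ => F (y * exp (t • (fromBlocks 1 1 (I • 1) (-(I • 1)) * fromBlocks ((2 * I : ℂ)⁻¹ • (α + (α)ᴴ)) ((2 * I : ℂ)⁻¹ •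 (β - (γ)ᴴ)) ((2 * I : ℂ)⁻¹ • (γ - (β)ᴴ)) ((2 * I : ℂ)⁻¹ • (δ + (δ)ᴴ)) * ((2 : ℂ)⁻¹ • fromBlocks 1 (-(I • 1)) 1 (I • 1)) : Matrix (Fin 2 ⊕ Fin 2) (Fin 2 ⊕ Fin 2) ℂ)))) 0)
          ((2 : ℂ)⁻¹ • fromBlocks (1 + v) (-(I • (1 - v))) (I • (1 - v)) (1 + v) : Matrix (Fin 2 ⊕ Fin 2) (Fin 2 ⊕ Fin 2) ℂ) = evalAt v hv
          (∑ a' : Fin 2, ∑ b' : Fin 2, β a' b' • pOp pd uMat dInv (s + 1 + (-(k : ℂ)) / 2) a' b' Q +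
          ∑ a' : Fin 2, ∑ b' : Fin 2, γ a' b' • mOp pd uMat (s + 1 - (-(k : ℂ)) / 2) a' b' Q + ((-(k : ℂ)) * (α).trace) • Q -
          ∑ a' : Fin 2, ∑ b' : Fin 2, α a' b' • lOp pd uMat a' b' Q + ∑ a' : Fin 2, ∑ b' : Fin 2, δ a' b' • rOp pd uMat a' b' Q)) ∧
      (∀ (u : Matrix (Fin 2) (Fin 2) ℂ), uᴴ * u = 1 → ∀ hu' : u.det ≠ 0,
        archIntertwining (fun y : Matrix (Fin 2 ⊕ Fin 2) (Fin 2 ⊕ Fin 2) ℂ => deriv (fun t : ℝ => F (y * exp (t • (fromBlocks 1 1 (I • 1) (-(I • 1)) * fromBlocks ((2 : ℂ)⁻¹ • (α - (α)ᴴ)) ((2 : ℂ)⁻¹ • (β + (γ)ᴴ)) ((2 : ℂ)⁻¹ • (γ + (β)ᴴ)) ((2 : ℂ)⁻¹ • (δ - (δ)ᴴ)) * ((2 : ℂ)⁻¹ • fromBlocks 1 (-(I • 1)) 1 (I • 1)) : Matrix (Fin 2 ⊕ Fin 2) (Fin 2 ⊕ Fin 2) ℂ)))) 0 + I * deriv (fun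 t : ℝ => F (y * exp (t • (fromBlocks 1 1 (I • 1) (-(I • 1)) * fromBlocks ((2 * I : ℂ)⁻¹ • (α + (α)ᴴ)) ((2 * I : ℂ)⁻¹ • (β - (γ)ᴴ)) ((2 * I : ℂ)⁻¹ • (γ - (β)ᴴ)) ((2 * I : ℂ)⁻¹ • (δ + (δ)ᴴ)) * ((2 : ℂ)⁻¹ • fromBlocks 1 (-(I • 1)) 1 (I • 1)) : Matrix (Fin 2 ⊕ Fin 2) (Fin 2 ⊕ Fin 2) ℂ)))) 0)
          ((2 : ℂ)⁻¹ • fromBlocks (1 + u) (-(I • (1 - u))) (I • (1 - u)) (1 + u) : Matrix (Fin 2 ⊕ Fin 2) (Fin 2 ⊕ Fin 2) ℂ) = evalAt u hu'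
          (∑ a' : Fin 2, ∑ b' : Fin 2, β a' b' • pOp pd uMat dInv (-s + 1 + (-(k : ℂ)) / 2) a' b' Q' +
          ∑ a' : Fin 2, ∑ b' : Fin 2, γ a' b' • mOp pd uMat (-s + 1 - (-(k : ℂ)) / 2) a' b' Q' + ((-(k : ℂ)) * (α).trace) • Q' -
          ∑ a' : Fin 2, ∑ b' : Fin 2, α a' b' • lOp pd uMat a' b' Q' + ∑ a' : Fin 2, ∑ b' : Fin 2, δ a' b' • rOp pd uMat a' b' Q')) := by
  refine ⟨?_, fun v hv hv' => ?_, fun u hu hu' => ?_⟩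
  · exact isArchSiegelSection_add (isArchSiegelSection_rayDeriv hF _) (isArchSiegelSection_const_mul I (isArchSiegelSection_rayDeriv hF _))
  · have h₁ := rayDeriv_kU_eq_evalAt_op k s hF Q hFQ _ _ _ _ (cayley_re_mem_lie α β γ δ) v hv hv'
    have h₂ := rayDeriv_kU_eq_evalAt_op k s hF Q hFQ _ _ _ _ (cayley_im_mem_lie α β γ δ) v hv hv'
    beta_reduce at h₁ h₂ ⊢
    rw [h₁, h₂, evalAt_add_I_mul, ← op_re_add_I_smul_im k s α β γ δ Q]
  · have hG := isArchSiegelSection_archIntertwining k s hF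
    have hI₁ := integrable_and_hasDerivAt_archIntertwining_rayDeriv k hs hF Q hFQ _ _ _ _ (cayley_re_mem_lie α β γ δ) (kU_mem_UJ hu)
    have hI₂ := integrable_and_hasDerivAt_archIntertwining_rayDeriv k hs hF Q hFQ _ _ _ _ (cayley_im_mem_lie α β γ δ) (kU_mem_UJ hu)
    have e₁ := apply_kU_eq_evalAt_op_of_hasDerivAt k (-s) (G := fun y => archIntertwining F y) (D := fun y => archIntertwining (fun y' : Matrix (Fin 2 ⊕ Fin 2) (Fin 2 ⊕ Fin 2) ℂ => deriv (fun t : ℝ => F (y' * exp (t • (fromBlocks 1 1 (I • 1) (-(I • 1)) * fromBlocks ((2 : ℂ)⁻¹ • (α - (α)ᴴ)) ((2 : ℂ)⁻¹ • (β + (γ)ᴴ)) ((2 : ℂ)⁻¹ • (γ + (β)ᴴ)) ((2 : ℂ)⁻¹ • (δ - (δ)ᴴ)) * ((2 : ℂ)⁻¹ • fromBlocks 1 (-(I • 1)) 1 (I • 1)) : Matrix (Fin 2 ⊕ Fin 2) (Fin 2 ⊕ Fin 2) ℂ)))) 0) y)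
      hG Q' hFM _ _ _ _ (cayley_re_mem_lie α β γ δ)
      (fun u₀ hu₀ => (integrable_and_hasDerivAt_archIntertwining_rayDeriv k hs hF Q hFQ _ _ _ _ (cayley_re_mem_lie α β γ δ) (kU_mem_UJ hu₀)).2) hu hu'
    have e₂ := apply_kU_eq_evalAt_op_of_hasDerivAt k (-s) (G := fun y => archIntertwining F y) (D := fun y => archIntertwining (fun y' : Matrix (Fin 2 ⊕ Fin 2) (Fin 2 ⊕ Fin 2) ℂ => deriv (fun t : ℝ => F (y' * exp (t • (fromBlocks 1 1 (I • 1) (-(I • 1)) * fromBlocks ((2 * I : ℂ)⁻¹ • (α + (α)ᴴ)) ((2 * I : ℂ)⁻¹ • (β - (γ)ᴴ)) ((2 * I : ℂ)⁻¹ • (γ - (β)ᴴ)) ((2 * I : ℂ)⁻¹ • (δ + (δ)ᴴ)) * ((2 : ℂ)⁻¹ • fromBlocks 1 (-(I • 1)) 1 (I • 1)) : Matrix (Fin 2 ⊕ Fin 2) (Fin 2 ⊕ Fin 2) ℂ)))) 0) y)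
      hG Q' hFM _ _ _ _ (cayley_im_mem_lie α β γ δ)
      (fun u₀ hu₀ => (integrable_and_hasDerivAt_archIntertwining_rayDeriv k hs hF Q hFQ _ _ _ _ (cayley_im_mem_lie α β γ δ) (kU_mem_UJ hu₀)).2) hu hu'
    beta_reduce at e₁ e₂ hI₁ hI₂ ⊢
    rw [archIntertwining_add (f₂ := fun x => I * (fun y' : Matrix (Fin 2 ⊕ Fin 2) (Fin 2 ⊕ Fin 2) ℂ => deriv (fun t : ℝ => F (y' * exp (t • (fromBlocks 1 1 (I • 1) (-(I • 1)) * fromBlocks ((2 * I : ℂ)⁻¹ • (α + (α)ᴴ)) ((2 * I : ℂ)⁻¹ • (β - (γ)ᴴ)) ((2 * I : ℂ)⁻¹ • (γ - (β)ᴴ)) ((2 * I : ℂ)⁻¹ • (δ + (δ)ᴴ)) * ((2 : ℂ)⁻¹ • fromBlocks 1 (-(I • 1)) 1 (I • 1)) : Matrix (Fin 2 ⊕ Fin 2) (Fin 2 ⊕ Fin 2) ℂ)))) 0) x) hI₁.1 (hI₂.1.const_mul I), archIntertwining_const_mul]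
    rw [e₁, e₂, evalAt_add_I_mul, ← op_re_add_I_smul_im k (-s) α β γ δ Q']

/-! ## §4  Along a word -/

/-- **THE PAIR ALONG A WORD** (`re s > ½`).  Blocks `(α β γ δ)_i` and consumer-supplied pictures with `Q_0 = Q′_0 = D^{−k}`, `Q_{i+1} = Op^{(k,s)}_i Q_i`,
`Q′_{i+1} = Op^{(k,−s)}_i Q′_i` for `i < n` ⇒ `∃ F ∈ I_w(s,χ_k)` with `cp F = Q_n`, `cp M_w F = c_k(s) • Q′_n` (★ asm FILE 2 `anchor` + `n ×` §3 `rung_pair`, ★ `op_smul`).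
[LeeZhu1998, §5 p. 5032, Prop. 5.4] [Shimura1982, (1.31)] -/
theorem ladder_pair (k : ℤ) {s : ℂ} (hs : 1 / 2 < s.re) (α β γ δ : ℕ → Matrix (Fin 2) (Fin 2) ℂ) (Q Q' : ℕ → Carrier)
    (hQ0 : Q 0 = dz (-k)) (hQ'0 : Q' 0 = dz (-k)) (n : ℕ)
    (hQ : ∀ i < n, Q (i + 1) = (∑ a' : Fin 2, ∑ b' : Fin 2, β i a' b' • pOp pd uMat dInv (s + 1 + (-(k : ℂ)) / 2) a' b' (Q i) +
          ∑ a' : Fin 2, ∑ b' : Fin 2, γ i a' b' • mOp pd uMat (s + 1 - (-(k : ℂ)) / 2) a' b' (Q i) + ((-(k : ℂ)) * (α i).trace) • (Q i) -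
          ∑ a' : Fin 2, ∑ b' : Fin 2, α i a' b' • lOp pd uMat a' b' (Q i) + ∑ a' : Fin 2, ∑ b' : Fin 2, δ i a' b' • rOp pd uMat a' b' (Q i)))
    (hQ' : ∀ i < n, Q' (i + 1) = (∑ a' : Fin 2, ∑ b' : Fin 2, β i a' b' • pOp pd uMat dInv (-s + 1 + (-(k : ℂ)) / 2) a' b' (Q' i) +
          ∑ a' : Fin 2, ∑ b' : Fin 2, γ i a' b' • mOp pd uMat (-s + 1 - (-(k : ℂ)) / 2) a' b' (Q' i) + ((-(k : ℂ)) * (α i).trace) • (Q' i) -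
          ∑ a' : Fin 2, ∑ b' : Fin 2, α i a' b' • lOp pd uMat a' b' (Q' i) + ∑ a' : Fin 2, ∑ b' : Fin 2, δ i a' b' • rOp pd uMat a' b' (Q' i))) :
    ∃ F : Matrix (Fin 2 ⊕ Fin 2) (Fin 2 ⊕ Fin 2) ℂ → ℂ, IsArchSiegelSection (fun z : ℂ => (conj z / ((‖z‖ : ℝ) : ℂ)) ^ k) s F ∧
      (∀ (v : Matrix (Fin 2) (Fin 2) ℂ), vᴴ * v = 1 → ∀ hv : v.det ≠ 0, F ((2 : ℂ)⁻¹ • fromBlocks (1 + v) (-(I • (1 - v))) (I • (1 - v)) (1 + v) : Matrix (Fin 2 ⊕ Fin 2) (Fin 2 ⊕ Fin 2) ℂ) = evalAt v hv (Q n)) ∧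
      (∀ (u : Matrix (Fin 2) (Fin 2) ℂ), uᴴ * u = 1 → ∀ hu' : u.det ≠ 0,
        archIntertwining F ((2 : ℂ)⁻¹ • fromBlocks (1 + u) (-(I • (1 - u))) (I • (1 - u)) (1 + u) : Matrix (Fin 2 ⊕ Fin 2) (Fin 2 ⊕ Fin 2) ℂ) = evalAt u hu' (archScalarCoeff k s • Q' n)) := by
  induction n with
  | zero =>
    obtain ⟨h0, h1, h2⟩ := anchor k hs
    refine ⟨archScalarSection k s, h0, fun v hv hv' => ?_, fun u hu hu' => ?_⟩
    · rw [h1 v hv hv', hQ0]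
    · rw [h2 u hu hu', hQ'0]
  | succ n ih =>
    obtain ⟨F, hF, hFQ, hFM⟩ := ih (fun i hi => hQ i (Nat.lt_succ_of_lt hi)) (fun i hi => hQ' i (Nat.lt_succ_of_lt hi))
    obtain ⟨h0, h1, h2⟩ := rung_pair k hs hF (Q n) (archScalarCoeff k s • Q' n) hFQ hFM (α n) (β n) (γ n) (δ n)
    exact ⟨_, h0, fun v hv hv' => (h1 v hv hv').trans (by rw [hQ n (Nat.lt_succ_self n)]),
      fun u hu hu' => (h2 u hu hu').trans (by rw [op_smul, hQ' n (Nat.lt_succ_self n)])⟩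

/-! ## §5  Reading the scalar off a pair -/

/-- **THE SCALAR EXTRACTION**: `F ∈ I_w(s,χ_k)` with `cp F = A • P`, `cp M_w F = B • P`, `A ≠ 0` ⇒ the section `A⁻¹·F` has `cp = P` and `cp M_w = (B∕A) • P`, i.e.
`M_w(s)` acts on the `K_w`-type through `P` by `B∕A` (with §4: `B = c_k(s)·B′`). [LeeZhu1998, Prop. 5.4] -/
theorem scalar_of_pair (k : ℤ) (s : ℂ) {F : Matrix (Fin 2 ⊕ Fin 2) (Fin 2 ⊕ Fin 2) ℂ → ℂ}
    (hF : IsArchSiegelSection (fun z : ℂ => (conj z / ((‖z‖ : ℝ) : ℂ)) ^ k) s F) (P : Carrier) (A B : ℂ) (hA : A ≠ 0)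
    (hFQ : ∀ (v : Matrix (Fin 2) (Fin 2) ℂ), vᴴ * v = 1 → ∀ hv : v.det ≠ 0, F ((2 : ℂ)⁻¹ • fromBlocks (1 + v) (-(I • (1 - v))) (I • (1 - v)) (1 + v) : Matrix (Fin 2 ⊕ Fin 2) (Fin 2 ⊕ Fin 2) ℂ) = evalAt v hv (A • P))
    (hFM : ∀ (u : Matrix (Fin 2) (Fin 2) ℂ), uᴴ * u = 1 → ∀ hu' : u.det ≠ 0,
        archIntertwining F ((2 : ℂ)⁻¹ • fromBlocks (1 + u) (-(I • (1 - u))) (I • (1 - u)) (1 + u) : Matrix (Fin 2 ⊕ Fin 2) (Fin 2 ⊕ Fin 2) ℂ) = evalAt u hu' (B • P)) :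
    IsArchSiegelSection (fun z : ℂ => (conj z / ((‖z‖ : ℝ) : ℂ)) ^ k) s (fun y => A⁻¹ * F y) ∧
      (∀ (v : Matrix (Fin 2) (Fin 2) ℂ), vᴴ * v = 1 → ∀ hv : v.det ≠ 0, (fun y => A⁻¹ * F y) ((2 : ℂ)⁻¹ • fromBlocks (1 + v) (-(I • (1 - v))) (I • (1 - v)) (1 + v) : Matrix (Fin 2 ⊕ Fin 2) (Fin 2 ⊕ Fin 2) ℂ) = evalAt v hv P) ∧
      (∀ (u : Matrix (Fin 2) (Fin 2) ℂ), uᴴ * u = 1 → ∀ hu' : u.det ≠ 0,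
        archIntertwining (fun y => A⁻¹ * F y) ((2 : ℂ)⁻¹ • fromBlocks (1 + u) (-(I • (1 - u))) (I • (1 - u)) (1 + u) : Matrix (Fin 2 ⊕ Fin 2) (Fin 2 ⊕ Fin 2) ℂ) = evalAt u hu' ((B / A) • P)) := by
  obtain ⟨h0, h1, h2⟩ := pair_const_mul k s hF (A • P) (B • P) A⁻¹ hFQ hFM
  refine ⟨h0, fun v hv hv' => ?_, fun u hu hu' => ?_⟩
  · rw [h1 v hv hv', smul_smul, inv_mul_cancel₀ hA, one_smul]
  · rw [h2 u hu hu', smul_smul, div_eq_inv_mul]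

end Summit.HodgeConjecture.HodgeConjecture.Cruxes.HLiu418.K2LiuArchLadderPairTransport

end
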